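import Summits.Parity.GeneralizedHardyLittlewood.Theorems.LeeYangFibresAbsoluteUpgradeQuantClipAssembly
import Summits.Parity.GeneralizedHardyLittlewood.Theorems.LeeYangFibresAbsoluteUpgradeSingularProductLogLog
import Summits.Parity.GeneralizedHardyLittlewood.Theorems.LeeYangFibresAbsoluteUpgradeSlices
import Summits.Parity.GeneralizedHardyLittlewood.Theorems.ModelHyperbolicity.Negative.ModelHyperbolicityNotMonotone
import HarnessLib

/-!
# Route `LeeYangFibres`, crux `AbsoluteUpgrade` (stmt-Parity-14116), line `dip-margin-rate-exchange`:
# the stub `stub_quantClip` (the RATE clipping lemma)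

We prove the registered stub
`stub_quantClip : CellParityLawSaving → FibreHyperbolicityAlong → MarginPoly → AnatomyAlong → PrimeCellsAbsolute`
of the skeleton `Cruxes/AbsoluteUpgrade/Lines/dip_margin_rate_exchange.lean` — the rate version of the PROVED
clipping lemma `Theorems.HyperbolicityClipsParity_proof` (`CellParityLaw → FibreHyperbolicity → ModelCellFacts →
PrimeCellsRelative`).  Differences: (i) the roughness `u = U(N) = slowDegree N` grows with `N`; (ii) instead of
Newton at two bulk indices, the WHOLE normalised fibre row is fed to `MarginPoly` (at `m = 2t`): real-rootedness
of the fibre (`FibreHyperbolicityAlong`) contradicts the margin's non-real zero unless the odd Walsh part is below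
`U^{-2t}` relative to the even part (`quantClip_marginBeta`, `quantClip_fibreClip`, `quantClip_thetaSmall`);
(iii) the error is made ABSOLUTE with the landed singular-product bound
`Theorems.AbsoluteUpgrade.stub_singularProduct_le_loglog_pow` (S1) and `β_∞ ≤ 2N`
(`Theorems.AbsoluteUpgrade.archFactor_le_two_mul`): `(log log N)^{t-1} ≤ (2U+2)^{2t-2}` loses against `U^{-2t}`.

The quantifier bookkeeping is `quantClip_assembly` (abstract cell data); here the route's objects enter by
unification exactly as in `HyperbolicityClipsParity_proof`: `cell := ModelTransfer.jointCell t`,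
`A N u m := Negative.cell u N m` (`Σ_m A_m ≤ N`: `sum_modelCells_le`; the top cell `A_u = 0`:
`Negative.cell_eq_zero_of_le`), `MS := β_∞ ∏_p β_p` (`≥ 0`: `archFactor_mul_singularProduct_nonneg`; growth:
`quantClip_massGrowth`), and the conclusion is transported to the sibling line's node
`NlcCellsAbsoluteClip.PrimeCellsAbsolute` by `primeCellsAbsolute_iff`.
-/

noncomputable section

namespace Summit.Parity.GeneralizedHardyLittlewood.Cruxes.AbsoluteUpgrade.DipMarginRateExchange

open scoped BigOperators Classical
open Literature.NumberTheory.Sieve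
open Summit.Parity.GeneralizedHardyLittlewood.Theses.LeeYangFibres
open Summit.Parity.GeneralizedHardyLittlewood.Theorems.ModelHyperbolicity.Negative (cell cell_eq_zero_of_le)
open Summit.Parity.GeneralizedHardyLittlewood.Cruxes.FibreHyperbolicity.ModelTransfer (jointCell fibre)
open Summit.Parity.GeneralizedHardyLittlewood.Theorems.HyperbolicityClipsParity (sum_modelCells_le
  archFactor_mul_singularProduct_nonneg)
open Summit.Parity.GeneralizedHardyLittlewood.Theorems.AbsoluteUpgrade (stub_singularProduct_le_loglog_pow
  archFactor_le_two_mul)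

/-- **The mass growth** (S1 and `β_∞ ≤ 2N`): `β_∞(Ψ,K) ∏_p β_p(Ψ) ≤ 2 C(t,L) · N · (log log N)^{t-1}` uniformly
over non-degenerate `Ψ` with `‖Ψ‖_N ≤ L` and `K ⊆ [-N, N]`, for `N ≥ N₀`. -/
theorem quantClip_massGrowth (t L : ℕ) (ht : 1 ≤ t) :
    ∃ C : ℝ, 0 < C ∧ ∃ N₀ : ℕ, ∀ N : ℕ, N₀ ≤ N → ∀ Ψ : Fin t → AffLinForm 1,
      IsNondegenerateSystem Ψ → affLinSize Ψ N ≤ L → ∀ K : Set (Fin 1 → ℝ), K ⊆ realBox 1 N →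
        archFactor Ψ K * singularProduct Ψ ≤ C * N * Real.log (Real.log N) ^ (t - 1) := by
  obtain ⟨C, hC, N₀, h⟩ := stub_singularProduct_le_loglog_pow t L ht
  refine ⟨2 * C, by positivity, max N₀ 16, fun N hN Ψ hΨ hL K hK => ?_⟩
  have hN₀ : N₀ ≤ N := le_trans (le_max_left _ _) hN
  have hN16 : 16 ≤ N := le_trans (le_max_right _ _) hN
  have hS := h N hN₀ Ψ hΨ hL
  have hA := archFactor_le_two_mul Ψ hK
  have hA0 : 0 ≤ archFactor Ψ K := ENNReal.toReal_nonneg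
  have hll : 0 ≤ Real.log (Real.log N) ^ (t - 1) := by
    refine pow_nonneg (Real.log_nonneg ?_) _
    rw [Real.le_log_iff_exp_le (by positivity)]
    have h16 : (16 : ℝ) ≤ N := by exact_mod_cast hN16
    have := Real.exp_one_lt_d9
    linarith
  calc archFactor Ψ K * singularProduct Ψ
      ≤ archFactor Ψ K * (C * Real.log (Real.log N) ^ (t - 1)) := mul_le_mul_of_nonneg_left hS hA0
    _ ≤ (2 * N) * (C * Real.log (Real.log N) ^ (t - 1)) := mul_le_mul_of_nonneg_right hA (by positivity)
    _ = 2 * C * N * Real.log (Real.log N) ^ (t - 1) := by ring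

/-- **Stub `stub_quantClip` (registered): the rate clipping lemma.**  The cell-parity law with a log-power
saving and fibre hyperbolicity along the schedule `U(N)`, the margin statement `MarginPoly` and the anatomy
along the schedule give the prime corner cell with ABSOLUTE error `ε N/log^t N` at roughness `u = U(N) ≥ 4`
(`quantClip_assembly` instantiated at the route's objects, then `primeCellsAbsolute_iff`). -/
theorem stub_quantClip : CellParityLawSaving → FibreHyperbolicityAlong → MarginPoly → AnatomyAlong → NlcCellsAbsoluteClip.PrimeCellsAbsolute := by
  intro hLaw hHyp hMargin hAnat
  rw [primeCellsAbsolute_iff]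
  intro t L ht ε hε
  obtain ⟨N₀, h⟩ := quantClip_assembly ht (cell := fun N u Ψ K j => jointCell t N u Ψ K j)
    (A := fun N u m => cell u N m) (MS := fun Ψ K => archFactor Ψ K * singularProduct Ψ)
    (fun N u => sum_modelCells_le N u) (fun N u hu => cell_eq_zero_of_le hu le_rfl)
    (fun Ψ K hΨ => archFactor_mul_singularProduct_nonneg Ψ hΨ K) (fun L => quantClip_massGrowth t L ht)
    (fun L => hLaw t L ht) (fun L η hη => hHyp t L ht η hη) hMargin hAnat L ε hε
  exact ⟨N₀, fun N hN => ⟨slowDegree N, le_trans (by norm_num) (four_le_slowDegree N), h N hN⟩⟩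

end Summit.Parity.GeneralizedHardyLittlewood.Cruxes.AbsoluteUpgrade.DipMarginRateExchange

end
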